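import Literature.AnabelianGeometry.AbsoluteAnabelian.HolomorphicCores
import Literature.AnabelianGeometry.AbsoluteAnabelian.FundamentalExtension
import Mathlib.Topology.Compactification.OnePoint.Basic
import Mathlib.Topology.Instances.AddCircle.Defs
import Mathlib.Analysis.Analytic.Basic

/-!
# Local linear holomorphic structures via elliptic cuspidalization; Galois-theoretic
# reconstruction of Aut-holomorphic spaces ([AbsTopIII] Cor 2.7, 2.8, 2.9, Rmk 2.8.1–2.8.3)

Statements-first typing (D-0014) of S. Mochizuki, *Topics in absolute anabelian geometry III*, §2
(bib key `MochizukiAbsTopIII2015`; locators = kurims manuscript pages, lit key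
`paper:url-5493eb38cbb7`).  DRAFTED BY SEAT abc-iut-L4-t2 (v3, audit A21 fixes F7/F8/N2); filed by
seat abc-iut-L4-t12 (L4 rulings σ/υ) with the four review repairs of p407934 (eventual finiteness
of values in Cauchy sequences; compact vs non-compact one-parameter subgroups; uniqueness of the
torsion-free index-two subgroup stated on its own; "embedding" = injective, topology untyped).
* Cor 2.7 pp.58–60 — (a) `IsEllipticallyAdmissiblePresentation` on the data of Cor 2.4, (b)
  elliptic cuspidalization diagrams `𝔼 ↩ 𝕌 → 𝔼` and their torsion points (definitions), (c) density
  of torsion points / unique extension of the group law (named fact), (d) one-parameter subgroups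
  of `PSL₂(ℝ)` (named fact, concrete over Mathlib), (e) the resulting `LocalLinearHolStructure`.
* Cor 2.8 pp.63–64 — over an INTERFACE `NFCurveData` (outputs of Thm 1.9 (a), (d), (e); Thm 1.9 is
  seat abc-iut-L4-t1's — TODO-merge): (a) Cauchy sequences of NF-points, conductors, equivalence,
  `N(U,f)`, `X^top = X_v(k_v)` (HONEST definitions); (b) `Aut^hol(U_v)`, charts `f_U`,
  `𝒜_X(U_X) := f_U⁻¹ ∘ Aut^hol(U_v) ∘ f_U`, the reconstructed structure (definitions + schema).
* Cor 2.9 pp.64–65 — the limit formula `(v⃗, f) ↦ lim n·f((1/n)·ₓ v⃗)`, `ι_{U_X,x}`, and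
  `𝒜_x ∪ {0} ⥲ k_v` as a `Prop`-valued structure; Rmk 2.8.3 as a schema; Rmk 2.8.1/2.8.2 recorded
  (record-only until t1's Thm 1.9 output structure replaces the shim — audit A21-N2).
Deliberately NOT here: Rmk 2.7.1–2.7.4 (discussion).

**v2 (topology repair, finding F-w5d140-2, L4-lead rulings 2026-08-26T00:28:08Z / 00:44:30Z; filed by
seat abc-iut-w5-d140; every declaration NAME and binder shape of v1 = p408225 kept).**  The ONLY change of
substance is the body of `NFCurveData.N`: the basic sets `N(U,f)` of Cor 2.8 (a) are now typed THROUGH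
THE LIMIT VALUE — a Cauchy sequence belongs to `N(U,f)` iff its `f`-values are eventually finite and
converge to an element of `U` — so that the images of the `N(U,f)` in `X^top` are the sets
`{p | Lim f p ∈ U}` (`= f⁻¹(U)` for the genuine data), a sub-base of the topology of `X_v(k_v)`.  In v1 the
membership condition was the per-index condition `∀ j, f(x_j) ∈ U` on representatives, whose images are
the CLOSED-condition sets `{p | Lim f p ∈ closure U}`; finite intersections of those isolate points
(kernel witness on an honest toy inhabitant of the shim: `Cor28TopologyWitness.isOpen_singleton_x₀`,
cell staging `w5/w5-d140/subdag/Cor28TopologyWitness.lean`; regression in the same file: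
`not_isOpen_singleton_x₀_limit`).  `topXtop`, `Chart`, `IsReconstructedStructure`, `ReconstructsAutHol`,
`GlobalArchimedeanCompatibility` are textually unchanged; the uniqueness clause of `ReconstructsAutHol`
gains a docstring pointer to the charted-opens reading `NFCurveData.ReconstructsAutHolOnCharts` of the
Cor 2.8 sub-DAG statements file `ArchimedeanReconstructionCor28Sub.lean` (p414194).
-/

namespace Literature.AnabelianGeometry.AbsoluteAnabelian

open _root_.TopologicalSpace _root_.Topology _root_.Filter
open scoped _root_.Manifold _root_.ContDiff

universe u

/-! ### Corollary 2.7: local linear holomorphic structures via elliptic cuspidalization -/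

section EllipticCuspidalization

variable {Ucov : Type u} [TopologicalSpace Ucov]

/-- The **once-punctured torus** `(ℝ/ℤ)² ∖ {0}`: the topological type of "the Aut-holomorphic space
associated to a once-punctured elliptic curve". [cite: MochizukiAbsTopIII2015, Corollary 2.7 (a) pp.58–59] -/
def PuncturedTorus : Type := {x : AddCircle (1 : ℝ) × AddCircle (1 : ℝ) // x ≠ 0}
/-- The subspace topology on the punctured torus. [cite: MochizukiAbsTopIII2015, Corollary 2.7 (a) pp.58–59] -/
instance : TopologicalSpace PuncturedTorus := instTopologicalSpaceSubtype
/-- **Cor 2.7 (a)** on the data of Cor 2.4: the presentation `(U^top, 𝒜_U, π₁ ↪ Aut⁰(𝕌) = G)` is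
**elliptically admissible** — "by the definition of 'elliptically admissible', we may apply
Corollary 2.4, (c), to construct the semi-elliptic hyperbolic core `𝕏 → ℍ` … together with the
unique [cf. [Mzk21], Remark 3.1.1] double covering `𝔼 → ℍ` by an Aut-holomorphic space [i.e., the
covering determined by the unique torsion-free subgroup of index two of the group `Π` of Corollary
2.4, (c)]", `𝔼` being a once-punctured elliptic curve.  Typed: non-arithmetic in the commensurator
sense; the commensurator `Π` has EXACTLY ONE torsion-free subgroup of index two (uniqueness among
all such subgroups, as printed); and the quotient of `U^top` by it is a once-punctured torus.
[cite: MochizukiAbsTopIII2015, Corollary 2.7 (a) pp.58–59] -/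
structure IsEllipticallyAdmissiblePresentation (G π : Subgroup (Ucov ≃ₜ Ucov)) : Prop where
  nonArithmetic : IsMargulisNonArithmetic G π
  existsUnique_index_two : ∃! P : Subgroup (Ucov ≃ₜ Ucov),
    P ≤ (Subgroup.Commensurable.commensurator (π.subgroupOf G)).map G.subtype ∧
    P.relIndex ((Subgroup.Commensurable.commensurator (π.subgroupOf G)).map G.subtype) = 2 ∧
    IsMulTorsionFree P
  quotient_puncturedTorus : ∀ P : Subgroup (Ucov ≃ₜ Ucov),
    P ≤ (Subgroup.Commensurable.commensurator (π.subgroupOf G)).map G.subtype →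
    P.relIndex ((Subgroup.Commensurable.commensurator (π.subgroupOf G)).map G.subtype) = 2 →
    IsMulTorsionFree P →
    Nonempty (Quot (fun x y : Ucov => ∃ φ : P, (φ : Ucov ≃ₜ Ucov) x = y) ≃ₜ PuncturedTorus)

/-- **Cor 2.7 (b): an elliptic cuspidalization diagram** `𝔼 ↩ 𝕌 → 𝔼` ([Mzk21] Ex 3.2): "`𝕌 → 𝔼` is
an abelian finite étale covering [which necessarily extends to a covering of the one-point
compactification of `E^top`]; `E^top ↩ U^top` is an open immersion whose image is the complement of
a finite subset of `E^top`; `𝔼 ↩ 𝕌`, `𝕌 → 𝔼` are co-holomorphic".  Typed for `E`, `U` Riemann surfaces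
(`U` with its own complex structure; both maps morphisms of the associated Aut-holomorphic spaces)
with co-holomorphicity in the concrete form `IsCoHolomorphicRS` of `Coorientations.lean`.
[cite: MochizukiAbsTopIII2015, Corollary 2.7 (b) p.59] -/
structure EllipticCuspidalizationDiagram (E : Type u) [TopologicalSpace E] [ChartedSpace ℂ E] :
    Type (u + 1) where
  /-- The total space `U^top`. -/
  U : Type u
  [topU : TopologicalSpace U]
  [chartU : ChartedSpace ℂ U]
  /-- The finite étale covering `𝕌 → 𝔼`. -/
  cov : U → E
  /-- The open immersion `𝔼 ↩ 𝕌`. -/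
  imm : U → E
  cov_finiteEtale : IsFiniteEtale cov
  cov_morphism : IsMorphism (AutHolStructure.ofCharted U) (AutHolStructure.ofCharted E) cov
  /-- "abelian": the deck group of `cov` is commutative and acts transitively on fibres. -/
  cov_galois_abelian : (∀ φ ψ : deckGroup cov, φ * ψ = ψ * φ) ∧
    ∀ u u' : U, cov u = cov u' → ∃ φ : deckGroup cov, (φ : U ≃ₜ U) u = u'
  imm_openEmbedding : IsOpenEmbedding imm
  imm_morphism : IsMorphism (AutHolStructure.ofCharted U) (AutHolStructure.ofCharted E) imm
  imm_cofinite : (Set.range imm)ᶜ.Finite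
  coholomorphic : IsCoHolomorphicRS cov imm

attribute [instance] EllipticCuspidalizationDiagram.topU EllipticCuspidalizationDiagram.chartU

/-- **Cor 2.7 (b): the torsion points**: "the points in the complement of the image of such morphisms
`𝕌 ↪ 𝔼`" (over all diagrams). [cite: MochizukiAbsTopIII2015, Corollary 2.7 (b) p.59] -/
def cuspidalTorsionPoints (E : Type u) [TopologicalSpace E] [ChartedSpace ℂ E] : Set E :=
  {e | ∃ D : EllipticCuspidalizationDiagram E, e ∉ Set.range D.imm}

/-- **Cor 2.7 (c)**: "since the torsion points of (b) are dense in `E^top`, one may construct the group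
structure on [the one-point compactification of] `E^top` … as the unique topological group structure
that extends the group structure on the torsion points of (b)".  Typed for `𝔼` a punctured elliptic
curve (conformal hypothesis `IsPuncturedEllipticCurve`): the cuspidal torsion points are dense, and two topological
(additive, commutative) group structures on `OnePoint E` agreeing on them coincide.  Named `Prop` fact.
[cite: MochizukiAbsTopIII2015, Corollary 2.7 (c) p.59] -/
def TorsionPointsDenseUniqueGroupLaw : Prop :=
  ∀ (E : Type) [TopologicalSpace E] [T2Space E] [ChartedSpace ℂ E] [IsManifold 𝓘(ℂ, ℂ) ω E],
    IsPuncturedEllipticCurve E →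
    Dense (cuspidalTorsionPoints E) ∧
    ∀ (g₁ g₂ : AddCommGroup (OnePoint E)),
      @IsTopologicalAddGroup (OnePoint E) _ g₁.toAddGroup →
      @IsTopologicalAddGroup (OnePoint E) _ g₂.toAddGroup →
      (∀ x y : E, x ∈ cuspidalTorsionPoints E → y ∈ cuspidalTorsionPoints E →
        @HAdd.hAdd _ _ _ (@instHAdd _ g₁.toAdd) (x : OnePoint E) y =
          @HAdd.hAdd _ _ _ (@instHAdd _ g₂.toAdd) (x : OnePoint E) y) →
      g₁ = g₂
  where
  /-- `E` "is the Aut-holomorphic space associated to a once-punctured elliptic curve" (Cor 2.7 (a)): a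
  CONFORMAL hypothesis — `E` is biholomorphic to the complement of a point `t₀` in a compact connected
  Riemann surface `T` homeomorphic to a torus (a punctured-torus homeomorphism type alone would allow a
  funnel end — audit A21-F7). -/
  IsPuncturedEllipticCurve (E : Type) [TopologicalSpace E] [ChartedSpace ℂ E] : Prop :=
    ∃ (T : Type) (_ : TopologicalSpace T) (_ : T2Space T) (_ : CompactSpace T) (_ : ConnectedSpace T)
      (_ : ChartedSpace ℂ T) (_ : IsManifold 𝓘(ℂ, ℂ) ω T) (t₀ : T)
      (e : E ≃ₜ (({t₀}ᶜ : Set T) : Set T)),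
      Nonempty (T ≃ₜ AddCircle (1 : ℝ) × AddCircle (1 : ℝ)) ∧
      MDifferentiable 𝓘(ℂ, ℂ) 𝓘(ℂ, ℂ) (fun x => ((e x : ({t₀}ᶜ : Set T)) : T)) ∧
      MDifferentiable 𝓘(ℂ, ℂ) 𝓘(ℂ, ℂ)
        (fun t : (⟨{t₀}ᶜ, isOpen_compl_singleton⟩ : Opens T) => e.symm ⟨t.1, t.2⟩)

/-- **Cor 2.7 (d)**, the group-theoretic characterisation in `𝒜_𝕍(V^top) ≅ SL₂(ℝ)/{±1}`: "the
one-parameter subgroups … are precisely the closed connected subgroups for which the complement of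
some connected open neighborhood of the identity element fails to be connected" — while the same
item also uses "a compact one-parameter subgroup [i.e., a 'one-dimensional torus']", for which that
criterion FAILS (the complement of an open arc in a circle is connected).  We therefore type the
REPAIRED READING, a standard Lie-theoretic classification for `PSL₂(ℝ)` (closed subgroup theorem;
connected one-dimensional subgroups are hyperbolic, parabolic or elliptic), as two clauses and NOT
as the printed sentence alone (audit A21-F8; review of p407934): (1) NON-COMPACT one-parameter
subgroups = ranges of continuous injective homomorphisms from `ℝ` ⟺ the printed criterion, made
precise as "closed, connected, and `S ∖ {1}` disconnected"; (2) COMPACT one-parameter subgroups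
(one-dimensional tori) = ranges of continuous, non-injective, non-trivial homomorphisms from `ℝ` ⟺
closed subgroups homeomorphic to a circle.  Named `Prop` fact.
[cite: MochizukiAbsTopIII2015, Corollary 2.7 (d) p.59] -/
def OneParameterSubgroupsPSL2R : Prop :=
  let G := Matrix.SpecialLinearGroup (Fin 2) ℝ ⧸ Subgroup.center (Matrix.SpecialLinearGroup (Fin 2) ℝ)
  (∀ S : Subgroup G,
    (∃ f : Multiplicative ℝ →* G, Continuous f ∧ Function.Injective f ∧ f.range = S) ↔
    (IsClosed (S : Set G) ∧ IsConnected (S : Set G) ∧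
      ¬ IsPreconnected ((Set.univ : Set S) \ {1}))) ∧
  (∀ S : Subgroup G,
    (∃ f : Multiplicative ℝ →* G, Continuous f ∧ ¬ Function.Injective f ∧ f ≠ 1 ∧ f.range = S) ↔
    (IsClosed (S : Set G) ∧ Nonempty (S ≃ₜ Circle)))

/-- **Cor 2.7 (d)/(e)**, the output object: from the local additive structures of (c) one constructs
line segments, parallels, parallelograms, frames, orientations (Prop 2.5 (a)–(d)), tangency to orbits of
one-parameter subgroups, orthogonal frames, and (e) the groups `𝒜_p` with "topological field
structures on `𝒜_p ∪ {0}`, together with compatible isomorphisms `𝒜_p ⥲ 𝒜_{p'}`" — "a system of local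
linear holomorphic structures on `E^top` or `X^top`".  For a space CHARTED over `ℂ` this system is the
tautological one, "`ℂ^×` at `p`" acting on tangent directions, with identity transitions: we record that
OUTPUT as a `LocalLinearHolStructure`; the content of Cor 2.7 is that it is recovered functorially from
the Aut-holomorphic orbispace alone (not separately typed: it needs germ actions, cf. Prop 2.6).
[cite: MochizukiAbsTopIII2015, Corollary 2.7 (e) p.60] -/
noncomputable def linHolStructureOfCharted (E : Type u) [TopologicalSpace E] [ChartedSpace ℂ E] :
    LocalLinearHolStructure E where
  A _ := ULift.{u} ℂˣ
  isoUnits _ :=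
    { MulEquiv.ulift.symm with
      continuous_toFun := continuous_uliftUp
      continuous_invFun := continuous_uliftDown }
  trans _ _ := ContinuousMulEquiv.refl _
  trans_self _ := rfl
  trans_comp _ _ _ := rfl
  trans_isoUnits _ _ := rfl

end EllipticCuspidalization

/-! ### Corollary 2.8: Galois-theoretic reconstruction of Aut-holomorphic spaces -/

namespace ArchimedeanReconstruction

/-- **Interface SHIM for Cor 2.8/2.9** (ruling α; TODO-merge abc-iut-L4-t1: replace by an `abbrev`
of t1's Thm 1.9 output structure): the outputs of Theorem 1.9 (a), (d), (e) that Cor 2.8 consumes,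
attached to the extension `1 → Δ_X → Π_X → G_k → 1` (`FundamentalExtension`) of a hyperbolic curve
`X` over a number field `k`: the NF-points of `X_v` ("conjugacy classes of decomposition groups of
NF-points in `Π_X` — cf. Theorem 1.9, (a)"), the NF-rational functions ("as in Theorem 1.9, (d)"),
the field `k̄_NF^× ∪ {0}` ("constructed in Theorem 1.9, (e)"), the divisor of poles and the values
`f(x) ∈ k̄_NF`, and an archimedean prime `v` realised as a dense embedding into a complete
archimedean field `k_v` ("the completion of `k̄_NF^× ∪ {0}` at `v`").
[cite: MochizukiAbsTopIII2015, Corollary 2.8 p.63] -/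
structure NFCurveData : Type 1 where
  /-- The extension `1 → Δ_X → Π_X → G_k → 1` of Thm 1.9 ("from the topological group `Π_X`"). -/
  ext : FundamentalExtension.{0}
  /-- NF-points of `X` (over `k̄`): conjugacy classes of decomposition groups in `Π_X`. -/
  Pt : Type
  /-- Each NF-point is (the conjugacy class of) a closed subgroup of `Π_X` (Thm 1.9 (a)). -/
  decomp : Pt → Subgroup ext.arith
  /-- NF-rational functions on `X_k̄`. -/
  Fn : Type
  /-- The field `k̄_NF` (`= k̄` for `k` a number field). -/
  kNF : Type
  [fieldNF : Field kNF]
  /-- The value of a function at a point; `none` = the point is a pole. -/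
  eval : Fn → Pt → Option kNF
  /-- The completion `k_v` at the archimedean prime `v`. -/
  kv : Type
  [fieldv : NontriviallyNormedField kv]
  [completev : CompleteSpace kv]
  /-- The embedding `k̄_NF ↪ k_v` defined by `v`. -/
  emb : kNF →+* kv
  denseRange_emb : DenseRange emb
  /-- `k_v` is archimedean: the norm of `2` exceeds `1` (a CAF or RAF). -/
  one_lt_norm_two : 1 < ‖(2 : kv)‖

attribute [instance] NFCurveData.fieldNF NFCurveData.fieldv NFCurveData.completev

variable (D : NFCurveData)

/-- The divisor of poles of `f` avoids the finite set `S`. [cite: MochizukiAbsTopIII2015, Corollary 2.8 (a) p.63] -/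
def NFCurveData.PolesAvoid (f : D.Fn) (S : Finset D.Pt) : Prop := ∀ x ∈ S, D.eval f x ≠ none

/-- The value `f(x) ∈ k_v` (junk `0` at a pole; only used where `IsCauchyWith.eventually_finite`
/ `N(U,f)` guarantee finiteness). [cite: MochizukiAbsTopIII2015, Corollary 2.8 (a) p.63] -/
def NFCurveData.valv (f : D.Fn) (x : D.Pt) : D.kv := ((D.eval f x).map D.emb).getD 0

/-- **Cor 2.8 (a): a Cauchy sequence of NF-points with conductor `S`**: "(i) `x_j ∉ S` for all but
finitely many `j`; (ii) for every NF-rational function `f` … whose divisor of poles avoids `S`, the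
sequence of [non-infinite, for all but finitely many `j` — cf. (i)] values `{f(x_j) ∈ k_v}` forms a
Cauchy sequence [in the usual sense] of `k_v`" — typed with the eventual finiteness of the values as
an explicit condition (`eventually_finite`; the finitely many infinite values are then replaced by
the junk value of `valv`, which cannot affect the Cauchy property).
[cite: MochizukiAbsTopIII2015, Corollary 2.8 (a) p.63] -/
structure NFCurveData.IsCauchyWith (x : ℕ → D.Pt) (S : Finset D.Pt) : Prop where
  eventually_not_mem : ∀ᶠ j in atTop, x j ∉ S
  eventually_finite : ∀ f : D.Fn, D.PolesAvoid f S → ∀ᶠ j in atTop, D.eval f (x j) ≠ none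
  cauchy : ∀ f : D.Fn, D.PolesAvoid f S → CauchySeq (fun j => D.valv f (x j))
/-- A **Cauchy sequence of NF-points** (some conductor). [cite: MochizukiAbsTopIII2015, Corollary 2.8 (a) p.63] -/
def NFCurveData.IsCauchy (x : ℕ → D.Pt) : Prop := ∃ S, D.IsCauchyWith x S

/-- **Cor 2.8 (a): equivalence** of Cauchy sequences admitting a common conductor `S`: for every `f`
whose poles avoid `S` the [eventually finite] value sequences "converge to the same element of `k_v`".
[cite: MochizukiAbsTopIII2015, Corollary 2.8 (a) p.63] -/
def NFCurveData.CauchyEquiv (x y : ℕ → D.Pt) : Prop :=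
  ∃ S, D.IsCauchyWith x S ∧ D.IsCauchyWith y S ∧ ∀ f : D.Fn, D.PolesAvoid f S →
    ∃ a : D.kv, Tendsto (fun j => D.valv f (x j)) atTop (𝓝 a) ∧
      Tendsto (fun j => D.valv f (y j)) atTop (𝓝 a)

/-- **Cor 2.8 (a): the sets `N(U,f)`**: Cauchy sequences `{x_j}` "such that `f(x_j)` [is finite and]
`∈ U`, for all `j`" (`U ⊆ k_v` open), typed THROUGH THE LIMIT VALUE: the values `f(x_j)` are eventually
finite and converge to an element of `U` (v2, repair of finding F-w5d140-2 / L4-lead ruling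
2026-08-26T00:28:08Z: with the literal per-index reading the image of `N(U,f)` in `X^top` is the
closed-condition set "`lim f(x_j) ∈ closure U`", and finite intersections of such images isolate points —
kernel witness `Cor28TopologyWitness.isOpen_singleton_x₀`, regression `not_isOpen_singleton_x₀_limit`,
staging/w5/w5-d140/subdag/Cor28TopologyWitness.lean; with the limit reading the image is `f⁻¹(U)`, a
sub-basic open of `X_v(k_v)`). [cite: MochizukiAbsTopIII2015, Corollary 2.8 (a) p.63] -/
def NFCurveData.N (U : Set D.kv) (f : D.Fn) : Set {x : ℕ → D.Pt // D.IsCauchy x} :=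
  {x | (∀ᶠ j in atTop, D.eval f (x.1 j) ≠ none) ∧
    ∃ a ∈ U, Tendsto (fun j => D.valv f (x.1 j)) atTop (𝓝 a)}

/-- **Cor 2.8 (a): the topological space `X^top = X_v(k_v)`** — "the set of equivalence classes of
Cauchy sequences of NF-points, equipped with the topology defined by the sets `N(U,f)`".
[cite: MochizukiAbsTopIII2015, Corollary 2.8 (a) p.63] -/
def NFCurveData.Xtop : Type :=
  Quot (fun x y : {x : ℕ → D.Pt // D.IsCauchy x} => D.CauchyEquiv x.1 y.1)

/-- The topology on `X^top` generated by the images of the `N(U,f)` — with `N` typed through the limit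
value (v2), the image of `N(U,f)` is `{p | Lim f p ∈ U}`, so this is the initial topology of the extended
NF-rational functions, i.e. "the topology defined by the sets `N(U,f)`" of print read as the topology
of `X_v(k_v)`. [cite: MochizukiAbsTopIII2015, Corollary 2.8 (a) p.63] -/
instance NFCurveData.topXtop : TopologicalSpace D.Xtop :=
  TopologicalSpace.generateFrom
    {W | ∃ (U : Set D.kv) (f : D.Fn), IsOpen U ∧ W = Quot.mk _ '' D.N U f}

open Classical in
/-- Extension by the identity of a self-map of an open subset `U ⊆ k` to `k` (to speak of its
analyticity at points of `U`, for `Aut^hol(U_v)`). [cite: MochizukiAbsTopIII2015, Corollary 2.8 (b) p.63] -/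
noncomputable def _root_.TopologicalSpace.Opens.extendHomeo {k : Type} [TopologicalSpace k]
    (U : Opens k) (φ : U ≃ₜ U) : k → k :=
  fun w => if h : w ∈ U then ((φ ⟨w, h⟩ : U) : k) else w

/-- **Cor 2.8 (b): `Aut^hol(U_v)`** for `U_v ⊆ k_v` open: "the group of self-homeomorphisms
`U_v ⥲ U_v` which, relative to the topological field structure of `k_v`, can locally be expressed as
a convergent power series with coefficients in `k_v`" (with analytic inverse).
[cite: MochizukiAbsTopIII2015, Corollary 2.8 (b) pp.63–64] -/
def NFCurveData.autHolv (Uv : Opens D.kv) : Subgroup (Uv ≃ₜ Uv) where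
  carrier := {φ | (∀ z : Uv, AnalyticAt D.kv (Uv.extendHomeo φ) z) ∧
    (∀ z : Uv, AnalyticAt D.kv (Uv.extendHomeo φ.symm) z)}
  one_mem' := by
    have h : ∀ z : Uv, AnalyticAt D.kv (Uv.extendHomeo (1 : Uv ≃ₜ Uv)) z := fun z => by
      refine (analyticAt_id).congr ?_
      filter_upwards [Uv.isOpen.mem_nhds z.2] with w hw
      rw [SetLike.mem_coe] at hw
      simp [Opens.extendHomeo, hw]
    exact ⟨h, h⟩
  mul_mem' := by
    rintro φ ψ ⟨hφ, hφ'⟩ ⟨hψ, hψ'⟩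
    refine ⟨fun z => ?_, fun z => ?_⟩
    · refine (((hφ (ψ z)).comp_of_eq (hψ z) (by simp [Opens.extendHomeo, z.2])).congr ?_)
      filter_upwards [Uv.isOpen.mem_nhds z.2] with w hw
      rw [SetLike.mem_coe] at hw
      simp [Opens.extendHomeo, hw, Homeomorph.mul_apply]
    · refine (((hψ' (φ.symm z)).comp_of_eq (hφ' z) (by simp [Opens.extendHomeo, z.2])).congr ?_)
      filter_upwards [Uv.isOpen.mem_nhds z.2] with w hw
      rw [SetLike.mem_coe] at hw
      simp [Opens.extendHomeo, hw]
      rfl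
  inv_mem' := by
    rintro φ ⟨hφ, hφ'⟩
    change (∀ z : Uv, AnalyticAt D.kv (Uv.extendHomeo φ.symm) z) ∧
      (∀ z : Uv, AnalyticAt D.kv (Uv.extendHomeo φ.symm.symm) z)
    exact ⟨hφ', fun z => by rw [Homeomorph.symm_symm]; exact hφ z⟩

/-- **Cor 2.8 (b): the charts `f_U`** — a connected open `U_X ⊆ X^top`, a connected open
`U_v ⊆ k_v` and an NF-rational function `f` "such that the function defined by `f` on `U_X` [i.e., by
taking limits of Cauchy sequences of values in `k_v`] determines a homeomorphism
`f_U : U_X ⥲ U_v`"; the groups `𝒜_X(U_X) := f_U⁻¹ ∘ Aut^hol(U_v) ∘ f_U`.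
[cite: MochizukiAbsTopIII2015, Corollary 2.8 (b) pp.63–64] -/
structure NFCurveData.Chart (UX : Opens D.Xtop) : Type where
  /-- The target open `U_v ⊆ k_v`. -/
  Uv : Opens D.kv
  /-- The NF-rational function `f`. -/
  f : D.Fn
  /-- The homeomorphism `f_U`. -/
  fU : UX ≃ₜ Uv
  /-- `f_U` is "the function defined by `f`": on the class of a Cauchy sequence `{x_j}` it is the
  limit of the values `f(x_j)`. -/
  fU_spec : ∀ (x : {x : ℕ → D.Pt // D.IsCauchy x}) (hx : Quot.mk _ x ∈ UX),
    Tendsto (fun j => D.valv f (x.1 j)) atTop (𝓝 ((fU ⟨Quot.mk _ x, hx⟩ : Uv) : D.kv))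

/-- `𝒜_X(U_X) := f_U⁻¹ ∘ Aut^hol(U_v) ∘ f_U ⊆ Aut(U_X)` for a chart. [cite: MochizukiAbsTopIII2015, Corollary 2.8 (b) p.64] -/
def NFCurveData.Chart.aut {UX : Opens D.Xtop} (c : D.Chart UX) : Subgroup (UX ≃ₜ UX) :=
  (D.autHolv c.Uv).map (homeoConj c.fU.symm).toMonoidHom
/-- **Cor 2.8 (b): the reconstructed Aut-holomorphic space `𝕏_v`**: "`𝒜_X` on `X^top` as the unique …
Aut-holomorphic structure that extends the pre-Aut-holomorphic structure determined by the groups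
`𝒜_X(U_X)`" — the predicate: `A` agrees with `f_U⁻¹ ∘ Aut^hol(U_v) ∘ f_U` on every charted connected open.
[cite: MochizukiAbsTopIII2015, Corollary 2.8 (b) p.64] -/
def NFCurveData.IsReconstructedStructure (A : AutHolStructure D.Xtop) : Prop :=
  ∀ (UX : ConnectedOpens D.Xtop) (c : D.Chart UX.1), IsConnected (c.Uv : Set D.kv) →
    A.aut UX = c.aut

/-- **Cor 2.8**, the assertion: for `X` a hyperbolic curve over a number field `k` and `v`
archimedean, the algorithm (a), (b) reconstructs "the Aut-holomorphic space `𝕏_v` associated to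
`X_v = X ×_k k_v`", functorially in open injective homomorphisms of `Π_X` compatible with `v`.
Typed over the interface as: a reconstructed structure exists and is unique.  (The comparison
with the analytic space of `X_v`, and the functoriality, need the scheme side — seat abc-iut-L4-t1's
`ArisesFrom` data; recorded, not typed here.)  Named `Prop` schema.  CAVEAT (v2, finding F-w5d140-2,
second clause): the `∃!` ranges over ARBITRARY assignments `U ↦ A(U) ≤ Aut(U^top)` on connected opens,
whereas print's "unique [cf. Corollary 2.3, (ii)]" is uniqueness among Aut-holomorphic structures of
Riemann surfaces; on a connected open admitting no chart into `k_v` (e.g. one containing a handle) this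
schema constrains nothing, so for genus `≥ 1` data the `∃!` is stronger than print — the charted-opens
reading is `NFCurveData.ReconstructsAutHolOnCharts` (Cor 2.8 sub-DAG statements file
`ArchimedeanReconstructionCor28Sub.lean`, p414194), which this schema implies
(`reconstructsAutHolOnCharts_of_reconstructsAutHol`).  Statement unchanged (name/shape frozen for the
consumers). [cite: MochizukiAbsTopIII2015, Corollary 2.8 pp.63–64] -/
def NFCurveData.ReconstructsAutHol : Prop := ∃! A : AutHolStructure D.Xtop, D.IsReconstructedStructure A

/-- **Rmk 2.8.3**: "any elliptically admissible hyperbolic orbicurve defined over a number field is of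
strictly Belyi type" — so Cor 2.7 applies to the Aut-holomorphic orbispaces of Cor 2.8.  Named
`Prop` SCHEMA over the predicates `IsEllipticallyAdmissible`, `IsStrictlyBelyiType`, `IsNF` of the
π₁-interface (owners abc-iut-L4-t4 / abc-iut-L4-t1; TODO-merge): stated for an abstract type of
curves-with-base-field and the three predicates.
[cite: MochizukiAbsTopIII2015, Remark 2.8.3 p.64] -/
def EllipticallyAdmissibleOverNFIsStrictlyBelyi (Curve : Type u)
    (IsEllipticallyAdmissible IsStrictlyBelyiType IsDefinedOverNF : Curve → Prop) : Prop :=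
  ∀ X : Curve, IsDefinedOverNF X → IsEllipticallyAdmissible X → IsStrictlyBelyiType X

end ArchimedeanReconstruction

/-! ### Corollary 2.9: global-archimedean elliptically admissible compatibility -/

namespace ArchimedeanReconstruction

variable (D : NFCurveData)

/-- **Cor 2.9 (a)/(b)** over the reconstructed space `X^top` of Cor 2.8 equipped (Cor 2.7 (c)) with
local additive structures — here the datum `ladd x : (v⃗ near x) ↦ (1/n)·ₓ v⃗` — : (a) for an
NF-point `x ∈ X_v(k_v)` and `f` vanishing at `x`, "`(v⃗, f) ↦ lim_{n→∞} n · f((1/n) ·ₓ v⃗) ∈ k_v`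
depends only on the image `df|_x ∈ ω_x` of `f` in the Zariski cotangent space … and determines a
topological embedding `ι_{U_X,x} : U_X ↪ Hom_{k_v}(ω_x, k_v)` compatible with the local additive
structures"; (b) "the resulting `ι_{U_X,x}` determine an isomorphism of topological fields
`𝒜_x ∪ {0} ⥲ k_v`", compatibly with the `𝒜_{x₁} ∪ {0} ⥲ 𝒜_{x₂} ∪ {0}` of Cor 2.7 (e).  Typed as a
`Prop`-valued structure over the interface, a `LocalLinearHolStructure` on `X^top`, the cotangent
spaces `ω_x` as `k_v`-modules with the differential `f ↦ df|_x`, and the scaling datum.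
[cite: MochizukiAbsTopIII2015, Corollary 2.9 pp.64–65] -/
structure GlobalArchimedeanCompatibility (L : LocalLinearHolStructure D.Xtop)
    (isNFPoint : D.Xtop → Prop) (cot : D.Xtop → Type) [∀ x, AddCommGroup (cot x)]
    [∀ x, Module D.kv (cot x)] (d : ∀ x, D.Fn → cot x)
    (vanishesAt : D.Fn → D.Xtop → Prop)
    (scale : D.Xtop → ℕ → D.Xtop → D.Xtop)
    (fval : D.Fn → D.Xtop → D.kv) : Prop where
  /-- (a) the limit exists and depends only on `df|_x`. -/
  limit_depends_on_differential : ∀ x, isNFPoint x → ∀ f g : D.Fn, vanishesAt f x →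
    vanishesAt g x →
    d x f = d x g → ∀ v : D.Xtop, ∀ a : D.kv,
      Tendsto (fun n : ℕ => (n : D.kv) * fval f (scale x n v)) atTop (𝓝 a) →
      Tendsto (fun n : ℕ => (n : D.kv) * fval g (scale x n v)) atTop (𝓝 a)
  /-- (a) the induced map `ι_{U_X,x} : U_X → Hom_{k_v}(ω_x, k_v)` on a neighbourhood is injective
  (print: "a topological embedding"; the topology of `Hom_{k_v}(ω_x, k_v)` is not typed here —
  TODO(general form): `IsEmbedding ι` for the finite-dimensional `k_v`-vector-space topology). -/
  embedding : ∀ x, isNFPoint x → ∃ (UX : Opens D.Xtop) (ι : UX → (cot x →ₗ[D.kv] D.kv)),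
    x ∈ UX ∧ Function.Injective ι ∧
    ∀ (v : UX) (f : D.Fn), vanishesAt f x →
      Tendsto (fun n : ℕ => (n : D.kv) * fval f (scale x n v)) atTop (𝓝 (ι v (d x f)))
  /-- (b) the isomorphism of topological fields `𝒜_x ∪ {0} ⥲ k_v` on units: a continuous
  multiplicative isomorphism `𝒜_x ⥲ k_v^×` for NF-points `x`, compatible with the transition
  isomorphisms `𝒜_{x₁} ⥲ 𝒜_{x₂}`. -/
  units_iso : ∃ e : ∀ x, isNFPoint x → (L.A x ≃ₜ* (D.kv)ˣ),
    ∀ x₁ x₂ (h₁ : isNFPoint x₁) (h₂ : isNFPoint x₂),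
      (L.trans x₁ x₂).trans (e x₂ h₂) = e x₁ h₁

end ArchimedeanReconstruction

end Literature.AnabelianGeometry.AbsoluteAnabelian
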